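import Literature.NumberTheory.EllipticCurves.DescendedFrobeniusMatrix
import Summits.BirchSwinnertonDyer.BirchSwinnertonDyer.Theorems.CyclotomicUntwistGNineLeafFrobeniusTrace
import HarnessLib

/-!
# The leaf good models over `𝓞_L`, `L = ℚ₃(ζ₉)`, as `NineGoodModel`s, and their special fibres
# `y² = x³ − x ± γ̄₁` along EVERY reduction map `ρ : 𝓞_L →+* ZMod 3` (route `CyclotomicUntwist`; bridge (B1)
# between the D5 definition `WeierstrassCurve.IsDescendedFrobeniusMatrix` and LAW L-a3)

Cell `pub/bsd-wall` (D-0145 line `route-BirchSwinnertonDyer-CyclotomicUntwist`), seat `bsd-line-cycu-p3` (gen 7).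
Helper toward K1 `PSRankOneLowerHalfAtThree` (stmt-BirchSwinnertonDyer-21580) / K2 (21581), stub `stub_descendedFrobenius`
of line `dfrob` (cycu-p1 g5). THEOREMS ONLY (no definition, no named fact, no `sorry`); BSD is not proved by this file
and no crux or stub is.

The Literature definition `WeierstrassCurve.IsDescendedFrobeniusMatrix` (p623342) is phrased with the 3-ADIC currency
`KNine = CyclotomicField 9 ℚ_[3]`, `ONine = integralClosure ℤ_[3] KNine`, good models `W.NineGoodModel` (an equation `E`
over `ONine` with unit discriminant and a change of variables `C` over `KNine` with `C • (W ⊗ KNine) = E ⊗ KNine`) and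
special fibres `E.map ρ` along ring maps `ρ : ONine →+* ZMod 3`; its existence fact `isDescendedFrobeniusMatrix_exists`
delivers `tr M = 𝓜.specialFibreTrace ρ`. This file PORTS cycu-p1's two leaf recipes (`GNine.hasGoodReductionAt_leafII/IV`,
number-field currency) to that currency:

* `thetaInv_mul` — `θ·θ′ = 1` with `θ′ = −38 + 51ϖ − 21ϖ² − 14ϖ³ + 16ϖ⁴ − 4ϖ⁵`: the unit `θ` (`ϖ⁶ = −3θ`, `ϖ = 1 − ζ`)
  of the toolkit has norm `1` and an inverse in `ℤ[ϖ]` (any field; one `linear_combination` against `ϖ⁶ = −3θ`);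
* `ringHom_zeta_eq_one` — every `ρ : ONine →+* ZMod 3` has `ρ(ζ) = 1` (`ρ(ζ)⁹ = 1` in `𝔽₃`), hence `ρ(ϖ) = 0`, `ρ(θ′) = 1`;
* **`exists_nineGoodModel_leafII`**: the leaf-II cubic `y² = x³ + 3(3α₁ − g)x² + 9βx + 3(3γ₁ + g)` (`g = ±1`) has a
  `NineGoodModel` — coefficients `(0, y₂θ′, 0, y₄θ′², y₆θ′²)` with `y_i ∈ ℤ[ϖ]` the certificates of p610052
  (`GNineSpecialFibre.leafII_a_i_identity`, field identities, instantiated over `KNine`), change `(ϖ², gϖ²(1+ϖ), 0, 0)`,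
  `Δ = Δᵘ·θ′⁴`, `3 ∤ Δᵘ` — whose special fibre along EVERY `ρ` is **`⟨0, 0, 0, −1, γ̄₁⟩`**;
  **`exists_nineGoodModel_leafIV`**: likewise for `y² = x³ + 9αx² + 9(3β₁ − 1)x + 9(3γ₁ + g)` with `(ϖ³, −gϖ⁴ζ, 0, 0)`,
  coefficients `(0, y₂θ′², 0, y₄θ′², y₆θ′³)`, special fibre **`⟨0, 0, 0, −1, −γ̄₁⟩`**;
* `exists_nineGoodModel_specialFibreTrace_leafII/IV` — hence `𝓜.specialFibreTrace ρ = psUntwistedTrace` of the cubic over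
  `ℚ` (p618242 `psUntwistedTrace_leafII/IV_eq_trace`), for every `ρ`.

What is NOT here: the existence of some `ρ : ONine →+* ZMod 3` («`𝓞_L` is local with residue field `𝔽₃`», bridge (B2)).

References: J. Tate, LNM 476 (1975) §7 [Tate1975]; A. Kraus, Manuscripta Math. 69 (1990), Théorème (p = 3) [Kraus1990];
L. C. Washington, *Cyclotomic Fields*, Lemma 1.4 and Prop. 2.8 (units `(1 − ζ)⁶/3`) [Washington1997]; J. H. Silverman,
*AEC* VII.1 [SilvermanAEC2009]; N. M. Katz, LNM 868 (1981) §5.1 [Katz1981CrystallineDieudonne].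
-/

-- single-conjunct summit: `Summit.BirchSwinnertonDyer.BirchSwinnertonDyer.…` repeats the name by design
set_option linter.dupNamespace false
set_option autoImplicit false

noncomputable section

open WeierstrassCurve Literature.NumberTheory.EllipticCurves.DescendedFrobenius
  Summit.BirchSwinnertonDyer.BirchSwinnertonDyer.Theorems.GNine
  Summit.BirchSwinnertonDyer.BirchSwinnertonDyer.Theorems.GNineSpecialFibre

namespace Summit.BirchSwinnertonDyer.BirchSwinnertonDyer.Theorems.GNineFrobeniusTrace

/-! ### The unit `θ` and its inverse `θ′ ∈ ℤ[ϖ]` (any field) -/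

section Field

variable {K : Type*} [Field K]

/-- **`θ·θ′ = 1`**: `θ = 1 − 3ϖ + 6ϖ² − 7ϖ³ + 5ϖ⁴ − 2ϖ⁵` (`ϖ⁶ = −3θ`) is a unit with the explicit inverse
`θ′ = −38 + 51ϖ − 21ϖ² − 14ϖ³ + 16ϖ⁴ − 4ϖ⁵` (`N(θ) = 1`; `θθ′ − 1 = (−13 + 16ϖ − 8ϖ² − 4ϖ³ + 8ϖ⁴)·(ϖ⁶ + 3θ)`).
[cite: Washington1997, Prop. 2.8] -/
theorem thetaInv_mul (ϖ : K) (h6 : ϖ ^ 6 = -3 * (1 - 3 * ϖ + 6 * ϖ ^ 2 - 7 * ϖ ^ 3 + 5 * ϖ ^ 4 - 2 * ϖ ^ 5)) :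
    (1 - 3 * ϖ + 6 * ϖ ^ 2 - 7 * ϖ ^ 3 + 5 * ϖ ^ 4 - 2 * ϖ ^ 5) *
      (-38 + 51 * ϖ - 21 * ϖ ^ 2 - 14 * ϖ ^ 3 + 16 * ϖ ^ 4 - 4 * ϖ ^ 5) = 1 := by
  linear_combination (-13 + 16 * ϖ - 8 * ϖ ^ 2 - 4 * ϖ ^ 3 + 8 * ϖ ^ 4) * h6

/-- `u⁻ᵏ·X = y·θ′ʲ` from the certificate `X·θʲ = uᵏ·y` and `θθ′ = 1`. [folklore] -/
theorem inv_pow_mul_eq_of_cert {u X y θ θ' : K} (hu : u ≠ 0) (k j : ℕ) (hT : θ * θ' = 1)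
    (hI : X * θ ^ j = u ^ k * y) : u⁻¹ ^ k * X = y * θ' ^ j := by
  have hθj : θ ^ j * θ' ^ j = 1 := by rw [← mul_pow, hT, one_pow]
  have hX : X = u ^ k * (y * θ' ^ j) := by
    linear_combination θ' ^ j * hI - X * hθj
  rw [hX, inv_pow, ← mul_assoc, inv_mul_cancel₀ (pow_ne_zero k hu), one_mul]

/-- `(ϖ²)⁻¹² · (3⁴·D) = D·θ′⁴` (`ϖ²⁴ = 81θ⁴`). [folklore] -/
theorem inv_pow_twelve_two {ϖ θ' : K} (hϖ : ϖ ≠ 0)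
    (h6 : ϖ ^ 6 = -3 * (1 - 3 * ϖ + 6 * ϖ ^ 2 - 7 * ϖ ^ 3 + 5 * ϖ ^ 4 - 2 * ϖ ^ 5))
    (hT : (1 - 3 * ϖ + 6 * ϖ ^ 2 - 7 * ϖ ^ 3 + 5 * ϖ ^ 4 - 2 * ϖ ^ 5) * θ' = 1) (D : K) :
    (ϖ ^ 2)⁻¹ ^ 12 * ((3 : K) ^ 4 * D) = D * θ' ^ 4 := by
  refine inv_pow_mul_eq_of_cert (pow_ne_zero 2 hϖ) 12 4 hT ?_
  calc (3 : K) ^ 4 * D * (1 - 3 * ϖ + 6 * ϖ ^ 2 - 7 * ϖ ^ 3 + 5 * ϖ ^ 4 - 2 * ϖ ^ 5) ^ 4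
      = D * (-3 * (1 - 3 * ϖ + 6 * ϖ ^ 2 - 7 * ϖ ^ 3 + 5 * ϖ ^ 4 - 2 * ϖ ^ 5)) ^ 4 := by ring
    _ = (ϖ ^ 2) ^ 12 * D := by rw [← h6]; ring

/-- `(ϖ³)⁻¹² · (3⁶·D) = D·θ′⁶` (`ϖ³⁶ = 729θ⁶`). [folklore] -/
theorem inv_pow_twelve_three {ϖ θ' : K} (hϖ : ϖ ≠ 0)
    (h6 : ϖ ^ 6 = -3 * (1 - 3 * ϖ + 6 * ϖ ^ 2 - 7 * ϖ ^ 3 + 5 * ϖ ^ 4 - 2 * ϖ ^ 5))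
    (hT : (1 - 3 * ϖ + 6 * ϖ ^ 2 - 7 * ϖ ^ 3 + 5 * ϖ ^ 4 - 2 * ϖ ^ 5) * θ' = 1) (D : K) :
    (ϖ ^ 3)⁻¹ ^ 12 * ((3 : K) ^ 6 * D) = D * θ' ^ 6 := by
  refine inv_pow_mul_eq_of_cert (pow_ne_zero 3 hϖ) 12 6 hT ?_
  calc (3 : K) ^ 6 * D * (1 - 3 * ϖ + 6 * ϖ ^ 2 - 7 * ϖ ^ 3 + 5 * ϖ ^ 4 - 2 * ϖ ^ 5) ^ 6
      = D * (-3 * (1 - 3 * ϖ + 6 * ϖ ^ 2 - 7 * ϖ ^ 3 + 5 * ϖ ^ 4 - 2 * ϖ ^ 5)) ^ 6 := by ring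
    _ = (ϖ ^ 3) ^ 12 * D := by rw [← h6]; ring

end Field

/-! ### The 3-adic currency: `ζ ∈ 𝓞_L`, and every `ρ : 𝓞_L →+* ZMod 3` kills `ϖ = 1 − ζ` -/

/-- `ζ₉ ∈ KNine` is integral over `ℤ₃` (root of `X⁹ − 1`). [folklore] -/
theorem zeta_mem_ONine : IsCyclotomicExtension.zeta 9 ℚ_[3] KNine ∈ ONine := by
  rw [mem_integralClosure_iff]
  refine ⟨Polynomial.X ^ 9 - 1, Polynomial.monic_X_pow_sub_C 1 (by norm_num), ?_⟩
  simp [(IsCyclotomicExtension.zeta_spec 9 ℚ_[3] KNine).pow_eq_one]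

/-- **Every reduction map sends `ζ` to `1`**: `ρ(ζ)⁹ = 1` in `ZMod 3` forces `ρ(ζ) = 1`. [folklore] -/
theorem ringHom_zeta_eq_one (ρ : ONine →+* ZMod 3) :
    ρ ⟨IsCyclotomicExtension.zeta 9 ℚ_[3] KNine, zeta_mem_ONine⟩ = 1 := by
  have h9 : (⟨IsCyclotomicExtension.zeta 9 ℚ_[3] KNine, zeta_mem_ONine⟩ : ONine) ^ 9 = 1 :=
    Subtype.ext (by simpa using (IsCyclotomicExtension.zeta_spec 9 ℚ_[3] KNine).pow_eq_one)
  have h := congrArg ρ h9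
  rw [map_pow, map_one] at h
  have key : ∀ x : ZMod 3, x ^ 9 = 1 → x = 1 := by decide
  exact key _ h

/-- `ρ(ϖ) = 0` for `ϖ = 1 − ζ`. [folklore] -/
theorem ringHom_varpi_eq_zero (ρ : ONine →+* ZMod 3) :
    ρ (1 - ⟨IsCyclotomicExtension.zeta 9 ℚ_[3] KNine, zeta_mem_ONine⟩) = 0 := by
  rw [map_sub, map_one, ringHom_zeta_eq_one, sub_self]

/-- An integer prime to `3` is a unit of `𝓞_L` (it is a unit of `ℤ₃`). [folklore] -/
theorem isUnit_intCast_ONine {n : ℤ} (hn : ¬ (3 : ℤ) ∣ n) : IsUnit ((n : ℤ) : ONine) := by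
  have h3 : IsUnit ((n : ℤ) : ℤ_[3]) := by
    rw [PadicInt.isUnit_iff]
    refine le_antisymm (PadicInt.norm_le_one _) (not_lt.mp fun h ↦ hn ?_)
    exact (PadicInt.norm_int_lt_one_iff_dvd n).mp h
  have := h3.map (algebraMap ℤ_[3] ONine)
  simpa using this

/-! ### Leaf II -/

section LeafII

variable (α₁ β γ₁ g : ℤ)

/-- **The leaf-II good model over `𝓞_{ℚ₃(ζ₉)}` and its special fibre `y² = x³ − x + γ̄₁` along every reduction map.**
For `g = ±1` the cubic `y² = x³ + 3(3α₁ − g)x² + 9βx + 3(3γ₁ + g)` over `ℚ` has a `NineGoodModel` (change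
`(ϖ², gϖ²(1+ϖ), 0, 0)`, coefficients `y₂θ′, y₄θ′², y₆θ′²`, `Δ = Δᵘθ′⁴`) with `E.map ρ = ⟨0, 0, 0, −1, γ̄₁⟩` for EVERY
`ρ : ONine →+* ZMod 3`. [cite: Kraus1990, Théorème (p = 3)] [cite: Tate1975, §7] [cite: SilvermanAEC2009, VII.1] -/
theorem exists_nineGoodModel_leafII (hg : g ^ 2 = 1) :
    ∃ 𝓜 : ((⟨0, 3 * (3 * α₁ - g), 0, 9 * β, 3 * (3 * γ₁ + g)⟩ : WeierstrassCurve ℤ).map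
        (Int.castRingHom ℚ)).NineGoodModel,
      ∀ ρ : ONine →+* ZMod 3, 𝓜.specialFibre ρ = ⟨0, 0, 0, -1, (γ₁ : ZMod 3)⟩ := by
  -- the 3-adic data
  set ζ : KNine := IsCyclotomicExtension.zeta 9 ℚ_[3] KNine with hζdef
  have hζ : IsPrimitiveRoot ζ 9 := IsCyclotomicExtension.zeta_spec 9 ℚ_[3] KNine
  set ζO : ONine := ⟨ζ, zeta_mem_ONine⟩ with hζO
  have hζK : algebraMap ONine KNine ζO = ζ := rfl
  set ϖO : ONine := 1 - ζO with hϖO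
  set ϖ : KNine := (1 : KNine) - ζ with hϖdef
  have hϖK : algebraMap ONine KNine ϖO = ϖ := by rw [hϖO, map_sub, map_one, hζK]
  have hϖ0 : ϖ ≠ 0 := one_sub_zeta_ne_zero hζ
  have h6 := varpi_pow_six hζ
  rw [← hϖdef] at h6
  set θ'O : ONine := (-38 : ℤ) + (51 : ℤ) * ϖO + (-21 : ℤ) * ϖO ^ 2 + (-14 : ℤ) * ϖO ^ 3 + (16 : ℤ) * ϖO ^ 4
    + (-4 : ℤ) * ϖO ^ 5 with hθ'O
  set θO : ONine := (1 : ℤ) + (-3 : ℤ) * ϖO + (6 : ℤ) * ϖO ^ 2 + (-7 : ℤ) * ϖO ^ 3 + (5 : ℤ) * ϖO ^ 4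
    + (-2 : ℤ) * ϖO ^ 5 with hθO
  have hθ'K : algebraMap ONine KNine θ'O = -38 + 51 * ϖ - 21 * ϖ ^ 2 - 14 * ϖ ^ 3 + 16 * ϖ ^ 4 - 4 * ϖ ^ 5 := by
    simp only [hθ'O, map_add, map_mul, map_pow, map_intCast, hϖK]; push_cast; ring
  have hθK : algebraMap ONine KNine θO = 1 - 3 * ϖ + 6 * ϖ ^ 2 - 7 * ϖ ^ 3 + 5 * ϖ ^ 4 - 2 * ϖ ^ 5 := by
    simp only [hθO, map_add, map_mul, map_pow, map_intCast, hϖK]; push_cast; ring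
  have hTK : (1 - 3 * ϖ + 6 * ϖ ^ 2 - 7 * ϖ ^ 3 + 5 * ϖ ^ 4 - 2 * ϖ ^ 5) * algebraMap ONine KNine θ'O = 1 := by
    rw [hθ'K]; exact thetaInv_mul ϖ h6
  have hTO : θO * θ'O = 1 := by
    apply Subtype.ext
    show algebraMap ONine KNine (θO * θ'O) = algebraMap ONine KNine 1
    rw [map_mul, map_one, hθK]; exact hTK
  have hgK : (g : KNine) ^ 2 = 1 := by exact_mod_cast hg
  -- the coefficients `y_i ∈ ℤ[ϖ]` (p610052's certificates) and the model
  set y₂O : ONine := (-3 : ℤ) * ϖO ^ 2 * α₁ + (1 : ℤ) * ϖO ^ 2 * g + (-1 : ℤ) * ϖO ^ 4 * g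
    + (-1 : ℤ) * ϖO ^ 5 * g with hy₂O
  set y₄O : ONine := (-6 : ℤ) * g * α₁ + (2 : ℤ) * g ^ 2 + (12 : ℤ) * ϖO * g * α₁ + (-4 : ℤ) * ϖO * g ^ 2
    + (-1 : ℤ) * ϖO ^ 2 + (-18 : ℤ) * ϖO ^ 2 * g * α₁ + (6 : ℤ) * ϖO ^ 2 * g ^ 2 + (1 : ℤ) * ϖO ^ 3
    + (6 : ℤ) * ϖO ^ 3 * g * α₁ + (-2 : ℤ) * ϖO ^ 3 * g ^ 2 + (-1 : ℤ) * ϖO ^ 4 + (1 : ℤ) * ϖO ^ 4 * β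
    + (12 : ℤ) * ϖO ^ 4 * g * α₁ + (-4 : ℤ) * ϖO ^ 4 * g ^ 2 + (-2 : ℤ) * ϖO ^ 5 + (-18 : ℤ) * ϖO ^ 5 * g * α₁
    + (6 : ℤ) * ϖO ^ 5 * g ^ 2 + (3 : ℤ) * ϖO ^ 6 + (12 : ℤ) * ϖO ^ 6 * g * α₁ + (-4 : ℤ) * ϖO ^ 6 * g ^ 2
    + (-1 : ℤ) * ϖO ^ 7 + (-1 : ℤ) * ϖO ^ 8 + (2 : ℤ) * ϖO ^ 9 with hy₄O
  set y₆O : ONine := (1 : ℤ) * γ₁ + (3 : ℤ) * g + (-10 : ℤ) * ϖO * g + (19 : ℤ) * ϖO ^ 2 * g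
    + (1 : ℤ) * ϖO ^ 2 * g * β + (-22 : ℤ) * ϖO ^ 3 * g + (1 : ℤ) * ϖO ^ 3 * g * β + (1 : ℤ) * ϖO ^ 4 * α₁
    + (10 : ℤ) * ϖO ^ 4 * g + (2 : ℤ) * ϖO ^ 5 * α₁ + (3 : ℤ) * ϖO ^ 5 * g + (1 : ℤ) * ϖO ^ 6 * α₁
    + (-8 : ℤ) * ϖO ^ 6 * g + (4 : ℤ) * ϖO ^ 7 * g with hy₆O
  set E : WeierstrassCurve ONine := ⟨0, y₂O * θ'O ^ 1, 0, y₄O * θ'O ^ 2, y₆O * θ'O ^ 2⟩ with hE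
  have hu : ϖ ^ 2 ≠ 0 := pow_ne_zero _ hϖ0
  set C : VariableChange KNine := ⟨Units.mk0 (ϖ ^ 2) hu, (g : KNine) * ϖ ^ 2 * (1 + ϖ), 0, 0⟩ with hC
  -- `W ⊗ KNine` as a cubic with integer coefficients
  have hWK : ((⟨0, 3 * (3 * α₁ - g), 0, 9 * β, 3 * (3 * γ₁ + g)⟩ : WeierstrassCurve ℤ).map
      (Int.castRingHom ℚ)).map (algebraMap ℚ KNine) =
      ⟨0, 3 * (3 * (α₁ : KNine) - (g : KNine)), 0, 9 * (β : KNine), 3 * (3 * (γ₁ : KNine) + (g : KNine))⟩ := by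
    rw [WeierstrassCurve.map_map, cubic_map]; ext <;> simp
  -- the three coefficient identities, read in `KNine`
  have I₂ := leafII_a₂_identity ϖ α₁ g h6 hgK
  have I₄ := leafII_a₄_identity ϖ α₁ β g h6 hgK
  have I₆ := leafII_a₆_identity ϖ α₁ β γ₁ g h6 hgK
  -- the change of variables lands on `E`
  have hsmul : C • ((⟨0, 3 * (3 * α₁ - g), 0, 9 * β, 3 * (3 * γ₁ + g)⟩ : WeierstrassCurve ℤ).map
      (Int.castRingHom ℚ)).map (algebraMap ℚ KNine) = E.map (algebraMap ONine KNine) := by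
    rw [hWK, hC, chg_smul_cubic (ϖ ^ 2) hu, hE, cubic_map]
    simp only [map_mul, map_pow, WeierstrassCurve.mk.injEq, true_and]
    refine ⟨inv_pow_mul_eq_of_cert hu 2 1 hTK ?_, inv_pow_mul_eq_of_cert hu 4 2 hTK ?_,
      inv_pow_mul_eq_of_cert hu 6 2 hTK ?_⟩
    · simp only [hy₂O, map_add, map_mul, map_pow, map_intCast, hϖK]
      linear_combination I₂
    · simp only [hy₄O, map_add, map_mul, map_pow, map_intCast, hϖK]
      linear_combination I₄
    · simp only [hy₆O, map_add, map_mul, map_pow, map_intCast, hϖK]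
      linear_combination I₆
  -- the discriminant is the unit `Δᵘ · θ′⁴`
  have hΔuint := PSUntwistedTrace.leafII_Δ_eq α₁ β γ₁ g
  have h3Δu := leafII_not_three_dvd_Δu α₁ β γ₁ hg
  set Δu : ℤ := (64 * g ^ 4 + 192 * γ₁ * g ^ 3 + 144 * β ^ 2 * g ^ 2 - 576 * α₁ * g ^ 3 - 1728 * α₁ * γ₁ * g ^ 2
        - 864 * α₁ * β ^ 2 * g + 1728 * α₁ ^ 2 * g ^ 2 + 5184 * α₁ ^ 2 * γ₁ * g + 1296 * α₁ ^ 2 * β ^ 2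
        - 1728 * α₁ ^ 3 * g - 5184 * α₁ ^ 3 * γ₁ - 288 * β * g ^ 2 - 864 * β * γ₁ * g - 576 * β ^ 3
        + 864 * α₁ * β * g + 2592 * α₁ * β * γ₁ - 48 * g ^ 2 - 288 * γ₁ * g - 432 * γ₁ ^ 2) with hΔu
  have hCu : ((C.u⁻¹ : KNineˣ) : KNine) = (ϖ ^ 2)⁻¹ := by
    rw [Units.val_inv_eq_inv_val, hC, Units.val_mk0]
  have hΔE : E.Δ = (Δu : ONine) * θ'O ^ 4 := by
    apply Subtype.ext
    show algebraMap ONine KNine E.Δ = algebraMap ONine KNine ((Δu : ONine) * θ'O ^ 4)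
    rw [← WeierstrassCurve.map_Δ, ← hsmul, variableChange_Δ, WeierstrassCurve.map_Δ, WeierstrassCurve.map_Δ,
      hΔuint, hCu]
    simp only [map_mul, map_pow, eq_intCast, map_intCast, map_ofNat]
    exact inv_pow_twelve_two hϖ0 h6 hTK _
  have hΔunit : IsUnit E.Δ := by
    rw [hΔE]
    exact (isUnit_intCast_ONine h3Δu).mul ((IsUnit.of_mul_eq_one_right θO hTO).pow 4)
  refine ⟨⟨E, C, hΔunit, hsmul⟩, fun ρ ↦ ?_⟩
  -- the special fibre along `ρ`
  have hρϖ : ρ ϖO = 0 := ringHom_varpi_eq_zero ρ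
  have hρθ' : ρ θ'O = 1 := by
    have hθ1 : ρ θO = 1 := by
      simp only [hθO, map_add, map_mul, map_pow, map_intCast, hρϖ]; push_cast; ring
    have := congrArg ρ hTO
    rwa [map_mul, map_one, hθ1, one_mul] at this
  have e₂ : ρ y₂O = 0 := by
    simp only [hy₂O, map_add, map_mul, map_pow, map_intCast, hρϖ]; push_cast; ring
  have e₄ : ρ y₄O = -1 := by
    have h : ρ y₄O = ((-6 * g * α₁ + 2 * g ^ 2 : ℤ) : ZMod 3) := by
      simp only [hy₄O, map_add, map_mul, map_pow, map_intCast, hρϖ]; push_cast; ring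
    rw [h, show (-1 : ZMod 3) = ((-1 : ℤ) : ZMod 3) by norm_num, ZMod.intCast_eq_intCast_iff_dvd_sub]
    exact ⟨2 * g * α₁ - 1, by linear_combination (-2 : ℤ) * hg⟩
  have e₆ : ρ y₆O = (γ₁ : ZMod 3) := by
    have h : ρ y₆O = ((γ₁ + 3 * g : ℤ) : ZMod 3) := by
      simp only [hy₆O, map_add, map_mul, map_pow, map_intCast, hρϖ]; push_cast; ring
    rw [h, ZMod.intCast_eq_intCast_iff_dvd_sub]
    exact ⟨-g, by ring⟩
  change E.map ρ = _
  rw [hE]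
  simp only [WeierstrassCurve.map, map_zero, map_mul, map_pow, hρθ', one_pow, mul_one, e₂, e₄, e₆]

end LeafII

/-! ### Leaf IV -/

section LeafIV

variable (α β₁ γ₁ g : ℤ)

/-- **The leaf-IV good model over `𝓞_{ℚ₃(ζ₉)}` and its special fibre `y² = x³ − x − γ̄₁` along every reduction map.**
For `g = ±1` the cubic `y² = x³ + 9αx² + 9(3β₁ − 1)x + 9(3γ₁ + g)` over `ℚ` has a `NineGoodModel` (change
`(ϖ³, −gϖ⁴ζ, 0, 0)`, coefficients `y₂θ′², y₄θ′², y₆θ′³`, `Δ = Δᵘθ′⁶`) with `E.map ρ = ⟨0, 0, 0, −1, −γ̄₁⟩` for EVERY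
`ρ : ONine →+* ZMod 3`. [cite: Kraus1990, Théorème (p = 3)] [cite: Tate1975, §7] [cite: SilvermanAEC2009, VII.1] -/
theorem exists_nineGoodModel_leafIV (hg : g ^ 2 = 1) :
    ∃ 𝓜 : ((⟨0, 9 * α, 0, 9 * (3 * β₁ - 1), 9 * (3 * γ₁ + g)⟩ : WeierstrassCurve ℤ).map
        (Int.castRingHom ℚ)).NineGoodModel,
      ∀ ρ : ONine →+* ZMod 3, 𝓜.specialFibre ρ = ⟨0, 0, 0, -1, -(γ₁ : ZMod 3)⟩ := by
  -- the 3-adic data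
  set ζ : KNine := IsCyclotomicExtension.zeta 9 ℚ_[3] KNine with hζdef
  have hζ : IsPrimitiveRoot ζ 9 := IsCyclotomicExtension.zeta_spec 9 ℚ_[3] KNine
  set ζO : ONine := ⟨ζ, zeta_mem_ONine⟩ with hζO
  have hζK : algebraMap ONine KNine ζO = ζ := rfl
  set ϖO : ONine := 1 - ζO with hϖO
  set ϖ : KNine := (1 : KNine) - ζ with hϖdef
  have hϖK : algebraMap ONine KNine ϖO = ϖ := by rw [hϖO, map_sub, map_one, hζK]
  have hϖ0 : ϖ ≠ 0 := one_sub_zeta_ne_zero hζ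
  have h6 := varpi_pow_six hζ
  rw [← hϖdef] at h6
  set θ'O : ONine := (-38 : ℤ) + (51 : ℤ) * ϖO + (-21 : ℤ) * ϖO ^ 2 + (-14 : ℤ) * ϖO ^ 3 + (16 : ℤ) * ϖO ^ 4
    + (-4 : ℤ) * ϖO ^ 5 with hθ'O
  set θO : ONine := (1 : ℤ) + (-3 : ℤ) * ϖO + (6 : ℤ) * ϖO ^ 2 + (-7 : ℤ) * ϖO ^ 3 + (5 : ℤ) * ϖO ^ 4
    + (-2 : ℤ) * ϖO ^ 5 with hθO
  have hθ'K : algebraMap ONine KNine θ'O = -38 + 51 * ϖ - 21 * ϖ ^ 2 - 14 * ϖ ^ 3 + 16 * ϖ ^ 4 - 4 * ϖ ^ 5 := by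
    simp only [hθ'O, map_add, map_mul, map_pow, map_intCast, hϖK]; push_cast; ring
  have hθK : algebraMap ONine KNine θO = 1 - 3 * ϖ + 6 * ϖ ^ 2 - 7 * ϖ ^ 3 + 5 * ϖ ^ 4 - 2 * ϖ ^ 5 := by
    simp only [hθO, map_add, map_mul, map_pow, map_intCast, hϖK]; push_cast; ring
  have hTK : (1 - 3 * ϖ + 6 * ϖ ^ 2 - 7 * ϖ ^ 3 + 5 * ϖ ^ 4 - 2 * ϖ ^ 5) * algebraMap ONine KNine θ'O = 1 := by
    rw [hθ'K]; exact thetaInv_mul ϖ h6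
  have hTO : θO * θ'O = 1 := by
    apply Subtype.ext
    show algebraMap ONine KNine (θO * θ'O) = algebraMap ONine KNine 1
    rw [map_mul, map_one, hθK]; exact hTK
  have hgK : (g : KNine) ^ 2 = 1 := by exact_mod_cast hg
  -- the coefficients `y_i ∈ ℤ[ϖ]` (p610052's certificates) and the model
  set y₂O : ONine := (1 : ℤ) * ϖO ^ 4 * g + (-4 : ℤ) * ϖO ^ 5 * g + (1 : ℤ) * ϖO ^ 6 * α + (9 : ℤ) * ϖO ^ 6 * g
    + (-13 : ℤ) * ϖO ^ 7 * g + (12 : ℤ) * ϖO ^ 8 * g + (-7 : ℤ) * ϖO ^ 9 * g + (2 : ℤ) * ϖO ^ 10 * g with hy₂O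
  set y₄O : ONine := (-1 : ℤ) + (3 : ℤ) * β₁ + (-1 : ℤ) * ϖO ^ 2 + (5 : ℤ) * ϖO ^ 3 + (-13 : ℤ) * ϖO ^ 4
    + (-2 : ℤ) * ϖO ^ 4 * g * α + (22 : ℤ) * ϖO ^ 5 + (2 : ℤ) * ϖO ^ 5 * g * α + (-25 : ℤ) * ϖO ^ 6
    + (19 : ℤ) * ϖO ^ 7 + (-9 : ℤ) * ϖO ^ 8 + (2 : ℤ) * ϖO ^ 9 with hy₄O
  set y₆O : ONine := (-1 : ℤ) * γ₁ + (-789 : ℤ) * g + (3263 : ℤ) * ϖO * g + (1 : ℤ) * ϖO ^ 2 * α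
    + (-8233 : ℤ) * ϖO ^ 2 * g + (-5 : ℤ) * ϖO ^ 3 * α + (13903 : ℤ) * ϖO ^ 3 * g + (13 : ℤ) * ϖO ^ 4 * α
    + (-17095 : ℤ) * ϖO ^ 4 * g + (1 : ℤ) * ϖO ^ 4 * g * β₁ + (-22 : ℤ) * ϖO ^ 5 * α + (16169 : ℤ) * ϖO ^ 5 * g
    + (-1 : ℤ) * ϖO ^ 5 * g * β₁ + (25 : ℤ) * ϖO ^ 6 * α + (-12261 : ℤ) * ϖO ^ 6 * g + (-19 : ℤ) * ϖO ^ 7 * α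
    + (7611 : ℤ) * ϖO ^ 7 * g + (9 : ℤ) * ϖO ^ 8 * α + (-3828 : ℤ) * ϖO ^ 8 * g + (-2 : ℤ) * ϖO ^ 9 * α
    + (1507 : ℤ) * ϖO ^ 9 * g + (-438 : ℤ) * ϖO ^ 10 * g + (84 : ℤ) * ϖO ^ 11 * g
    + (-8 : ℤ) * ϖO ^ 12 * g with hy₆O
  set E : WeierstrassCurve ONine := ⟨0, y₂O * θ'O ^ 2, 0, y₄O * θ'O ^ 2, y₆O * θ'O ^ 3⟩ with hE
  have hu : ϖ ^ 3 ≠ 0 := pow_ne_zero _ hϖ0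
  set C : VariableChange KNine := ⟨Units.mk0 (ϖ ^ 3) hu, -(g : KNine) * ϖ ^ 4 * (1 - ϖ), 0, 0⟩ with hC
  -- `W ⊗ KNine` as a cubic with integer coefficients
  have hWK : ((⟨0, 9 * α, 0, 9 * (3 * β₁ - 1), 9 * (3 * γ₁ + g)⟩ : WeierstrassCurve ℤ).map
      (Int.castRingHom ℚ)).map (algebraMap ℚ KNine) =
      ⟨0, 9 * (α : KNine), 0, 9 * (3 * (β₁ : KNine) - 1), 9 * (3 * (γ₁ : KNine) + (g : KNine))⟩ := by
    rw [WeierstrassCurve.map_map, cubic_map]; ext <;> simp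
  -- the three coefficient identities, read in `KNine`
  have I₂ := leafIV_a₂_identity ϖ α g h6 hgK
  have I₄ := leafIV_a₄_identity ϖ α β₁ g h6 hgK
  have I₆ := leafIV_a₆_identity ϖ α β₁ γ₁ g h6 hgK
  -- the change of variables lands on `E`
  have hsmul : C • ((⟨0, 9 * α, 0, 9 * (3 * β₁ - 1), 9 * (3 * γ₁ + g)⟩ : WeierstrassCurve ℤ).map
      (Int.castRingHom ℚ)).map (algebraMap ℚ KNine) = E.map (algebraMap ONine KNine) := by
    rw [hWK, hC, chg_smul_cubic (ϖ ^ 3) hu, hE, cubic_map]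
    simp only [map_mul, map_pow, WeierstrassCurve.mk.injEq, true_and]
    refine ⟨inv_pow_mul_eq_of_cert hu 2 2 hTK ?_, inv_pow_mul_eq_of_cert hu 4 2 hTK ?_,
      inv_pow_mul_eq_of_cert hu 6 3 hTK ?_⟩
    · simp only [hy₂O, map_add, map_mul, map_pow, map_intCast, hϖK]
      linear_combination I₂
    · simp only [hy₄O, map_add, map_mul, map_pow, map_intCast, hϖK]
      linear_combination I₄
    · simp only [hy₆O, map_add, map_mul, map_pow, map_intCast, hϖK]
      linear_combination I₆
  -- the discriminant is the unit `Δᵘ · θ′⁶`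
  have hΔuint := PSUntwistedTrace.leafIV_Δ_eq α β₁ γ₁ g
  have h3Δu := PSUntwistedTrace.leafIV_not_three_dvd_Δu α β₁ γ₁ hg
  set Δu : ℤ := (1296 * α ^ 2 * β₁ ^ 2 - 576 * α ^ 3 * g - 1728 * α ^ 3 * γ₁ - 1728 * β₁ ^ 3 + 864 * α * β₁ * g
        + 2592 * α * β₁ * γ₁ - 864 * α ^ 2 * β₁ - 48 * g ^ 2 - 288 * γ₁ * g - 432 * γ₁ ^ 2 + 1728 * β₁ ^ 2
        - 288 * α * g - 864 * α * γ₁ + 144 * α ^ 2 - 576 * β₁ + 64) with hΔu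
  have hCu : ((C.u⁻¹ : KNineˣ) : KNine) = (ϖ ^ 3)⁻¹ := by
    rw [Units.val_inv_eq_inv_val, hC, Units.val_mk0]
  have hΔE : E.Δ = (Δu : ONine) * θ'O ^ 6 := by
    apply Subtype.ext
    show algebraMap ONine KNine E.Δ = algebraMap ONine KNine ((Δu : ONine) * θ'O ^ 6)
    rw [← WeierstrassCurve.map_Δ, ← hsmul, variableChange_Δ, WeierstrassCurve.map_Δ, WeierstrassCurve.map_Δ,
      hΔuint, hCu]
    simp only [map_mul, map_pow, eq_intCast, map_intCast, map_ofNat]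
    exact inv_pow_twelve_three hϖ0 h6 hTK _
  have hΔunit : IsUnit E.Δ := by
    rw [hΔE]
    exact (isUnit_intCast_ONine h3Δu).mul ((IsUnit.of_mul_eq_one_right θO hTO).pow 6)
  refine ⟨⟨E, C, hΔunit, hsmul⟩, fun ρ ↦ ?_⟩
  -- the special fibre along `ρ`
  have hρϖ : ρ ϖO = 0 := ringHom_varpi_eq_zero ρ
  have hρθ' : ρ θ'O = 1 := by
    have hθ1 : ρ θO = 1 := by
      simp only [hθO, map_add, map_mul, map_pow, map_intCast, hρϖ]; push_cast; ring
    have := congrArg ρ hTO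
    rwa [map_mul, map_one, hθ1, one_mul] at this
  have e₂ : ρ y₂O = 0 := by
    simp only [hy₂O, map_add, map_mul, map_pow, map_intCast, hρϖ]; push_cast; ring
  have e₄ : ρ y₄O = -1 := by
    have h : ρ y₄O = ((-1 + 3 * β₁ : ℤ) : ZMod 3) := by
      simp only [hy₄O, map_add, map_mul, map_pow, map_intCast, hρϖ]; push_cast; ring
    rw [h, show (-1 : ZMod 3) = ((-1 : ℤ) : ZMod 3) by norm_num, ZMod.intCast_eq_intCast_iff_dvd_sub]
    exact ⟨-β₁, by ring⟩
  have e₆ : ρ y₆O = -(γ₁ : ZMod 3) := by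
    have h : ρ y₆O = ((-γ₁ - 789 * g : ℤ) : ZMod 3) := by
      simp only [hy₆O, map_add, map_mul, map_pow, map_intCast, hρϖ]; push_cast; ring
    rw [h, show (-(γ₁ : ZMod 3)) = ((-γ₁ : ℤ) : ZMod 3) by push_cast; ring, ZMod.intCast_eq_intCast_iff_dvd_sub]
    exact ⟨263 * g, by ring⟩
  change E.map ρ = _
  rw [hE]
  simp only [WeierstrassCurve.map, map_zero, map_mul, map_pow, hρθ', one_pow, mul_one, e₂, e₄, e₆]

end LeafIV

end Summit.BirchSwinnertonDyer.BirchSwinnertonDyer.Theorems.GNineFrobeniusTrace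

end
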